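import Literature.NumberTheory.LFunctions.FordProgram1Run38A
import Literature.NumberTheory.LFunctions.FordProgram1Run38B
import Literature.NumberTheory.LFunctions.FordProgram1Run38C
import HarnessLib

/-!
# Ford's "Program 1": kernel run 38 (`1116 ≤ k ≤ 1130`)

Topic `Literature/NumberTheory/LFunctions`. Everything here is PROVED (standard axioms):
`FordP1.checkT k = true` for `1116 ≤ k ≤ 1130`, i.e. the certified re-run of PROGRAM 1 of
K. Ford, Proc. LMS 85 (2002) (the second part of Theorem 3) for these `k` — see `FordProgram1.lean`
for the checker, its soundness `FordP1.row_of_checkK`, and the meaning of the constants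
(`ρ = FordP1.rhoOf k / 10⁵`, `θ = FordP1.thetaOf k / 10⁴`, `ω = FordP1.omOf k / 10⁴`).

The kernel evaluations themselves live in the split files `FordProgram1Run38A.lean` (`1116 ≤ k ≤ 1121`),
`FordProgram1Run38B.lean` (`1122 ≤ k ≤ 1126`) and `FordProgram1Run38C.lean` (`1127 ≤ k ≤ 1130`), one
`decide +kernel` per `k` (a single monolithic `decide +kernel` over the whole range does not fit the
full build's resources); this file only re-assembles them into the original range statement
`FordP1.run38`, with no kernel evaluation of `checkT` here. The assembly of all runs is
`FordTheorem3SmallK.lean` (which uses the split statements `run38A`–`run38C` directly).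

## References

* K. Ford, Proc. London Math. Soc. (3) 85 (2002), 565–633; arXiv:1910.08209: Theorem 3, (1.7),
  Lemmas 3.4–3.5, Appendix "PROGRAM 1". [Ford2002]
-/

namespace Literature.NumberTheory.LFunctions
namespace FordP1

/-- **Kernel run 38**: `checkT k` for `1116 ≤ k ≤ 1130` (assembled from `run38A`, `run38B`,
`run38C`). [cite: Ford2002, Theorem 3 (second part) and PROGRAM 1] -/
theorem run38 : ((List.range' 1116 15).all checkT) = true := by
  rw [List.all_eq_true]
  intro k hk
  rw [List.mem_range'_1] at hk
  obtain ⟨h1, h2⟩ := hk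
  rcases lt_or_ge k 1122 with h3 | h3
  · exact run38A k h1 (by omega)
  rcases lt_or_ge k 1127 with h4 | h4
  · exact run38B k h3 (by omega)
  · exact run38C k h4 (by omega)

end FordP1
end Literature.NumberTheory.LFunctions
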